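import Literature.AnabelianGeometry.EtaleTheta.Discharge.Sec4NonVacuityTowerSetting
import Literature.AnabelianGeometry.EtaleTheta.Discharge.Sec4NonVacuityCoveringLaws
import Literature.AlgebraicGeometry.Frobenioids.ModelFrobenioidIsFrobenioid
import HarnessLib

/-!
# [EtTh] §4 over the GENUINE Kummer tower: `B` is a monoid on `D`, `C` IS a Frobenioid, roots exist ONLY
# upstairs, the laws of the Prop 4.2 (iii)∧(iv) floor hold and the closers fire (consistency witness, part 11)

S. Mochizuki, *The étale theta function and its Frobenioid-theoretic manifestations*, Publ. RIMS **45**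
(2009) [MochizukiEtTh2009], §4, Prop 4.2 (iii)(iv) p.88 and proof pp.89–90 (PDF) — ERRATUM E2 ([IUTchI]
Rmk 3.2.4): "over some tempered covering … `f` admits an `N`-th root"; [FrdI] Def 1.1 (ii), Thm 5.2 (ii).

CONSISTENCY WITNESS, TOY — PROOF-ONLY (no definition, no named fact, no instance, no `sorry`); sequel of
`Sec4NonVacuityTower.lean` (part 10: the genuine tower `Base` — deck transformations, covers not mono —, `Φ = ℚ_{≥0}`,
`B = ℂˣ × t^ℤ` with the twisted pull-back) and `Sec4NonVacuityTowerSetting.lean` (part 10b: `Π^tp_X ↠ ℤ ↠ ℤ/N =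
Aut(X_N)` from the R78 χ-model, `A_⊙ = (X_1, 0)`, `biKummerSetting p`, `μ_N`-saturation).  Proved here:

* `ToyTower.ratFnFunctor_isMonoidOn` — **`B = ℂˣ × t^ℤ` IS a monoid on the genuine tower** ([FrdI] Def 1.1 (ii)):
  the clause that FAILED on the collapsed base (`ToyCovZ.not_isMonoidOn_ratFnFunctor`, p430083) holds, because
  bijectivity of pull-backs is demanded only along FSM-morphisms and a monomorphism of the tower is an isomorphism
  (`Base.exists_iso_of_mono`: `Aut(X_N) = ℤ/N` acts transitively on fibres); `divisorMonoid_isMonoidOn` likewise;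
* `ToyTower.temperedFrobenioid_isFrobenioid` — **the tower IS a Frobenioid WITH INTEGRAL EXPONENTS** (REAL
  `PreFrobenioid.IsFrobenioid`, L1's [FrdI] Thm 5.2 (ii) `ModelFrobenioid.isFrobenioid`);
* `ToyTower.roots_only_upstairs` — **ERRATUM E2 in the kernel at a setting that IS a Frobenioid**: the uniformiser
  `t_M` has NO square root in `B(X_M)` (`not_exists_pow_eq_unif`, `2n = 1` insoluble) but acquires one on `X_{2M}`
  along the Kummer cover (`exists_pow_eq_pull_cover`: `c·t_M^n ↦ c·t_{NM}^{Nn} = (c^{1/N} t_{NM}^n)^N`) — the cell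
  the integral collapsed toy `ToyCovZ` could not fill (there "`C` is a Frobenioid" was unavailable);
* the six base-level LAWS of the node floor of record (SUBDAG-EtTh-Prop42 AMENDMENT v3 §D) — `rootLaw` (hR, E2,
  GAP G-w4d044-3, by the cover `X_{N·M} → X_M`), `constantRootLaw` (hL, G-w4d044-1), `refinementLaw` (hE,
  G-w4d044-2, `ψ = id`, REAL `μ_N`-saturation), `naturalityLaw` (hS, Def 4.1 (ii): the Galois actions commute with
  every `b : X_M → X_N` since they factor through the abelian `Π^tp_X ↠ ℤ`), `coprime_pull` (hDSpull),
  `divisorMonoid_isDivisorial` — and one level deeper `baseRootLaw` (hR₀), `pow_injective_ΦR_gp` (hTF);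
* `ToyTower.laws_and_prop42_iii_iv`, `ToyTower.baseLaws_and_prop42_iii_iv` — **abc-iut-w4-d044's floor closers
  `prop42_iii_iv_mkOfModelCanonical_of_laws` (p428253) and `…_of_baseRootLaw` (p432007) FIRE: the typed
  Prop 4.2 (iii) ∧ (iv) hold at `ToyTower.biKummerSetting p`** — at a setting with deck transformations, integral
  exponents, `C` a Frobenioid, roots only upstairs and non-trivial Galois groups hit by a slim tempered `Π^tp_X`.

READING (neutral): the binders of «(iii)∧(iv) ⇐ laws» are jointly satisfiable at a setting free of the two artefacts of
the collapsed toys.  HONEST LIMITS: a toy (𝔾_m; trivial [FrdI] vocabularies; `(N,H)`-slot `True`; Galois datum of the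
§1 root model acting through `Π^tp_X ↠ ℤ`); consistency ≠ faithfulness; typed ≠ proved; no side taken on [IUTchIII] Cor. 3.12.
-/

noncomputable section

namespace Literature.AnabelianGeometry.EtaleTheta

open CategoryTheory Opposite Literature.AlgebraicGeometry.Frobenioids
open scoped NNRat

namespace ToyTower

open Base

/-- Cast along the identity divisibility is the identity. [folklore] -/
private theorem castHom_self_apply' (B : Base) (x : ZMod B.lvl) :
    ZMod.castHom (dvd_rfl : (B.lvl : ℕ) ∣ B.lvl) (ZMod B.lvl) x = x :=
  RingHom.congr_fun (RingHom.ext_zmod (ZMod.castHom dvd_rfl (ZMod B.lvl)) (RingHom.id _)) x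

/-- On groupifications the `N`-th power map induces the `N`-th power map. [folklore] -/
private theorem gpMap_powMonoidHom' (M : Type) [CommMonoid M] (N : ℕ) :
    gpMap (powMonoidHom N : M →* M) = powMonoidHom N := by
  apply Algebra.GrothendieckGroup.lift.symm.injective
  rw [Algebra.GrothendieckGroup.lift_symm_apply, Algebra.GrothendieckGroup.lift_symm_apply]
  ext m
  change gpMap (powMonoidHom N) (Algebra.GrothendieckGroup.of m) = Algebra.GrothendieckGroup.of m ^ N
  rw [gpMap_of, powMonoidHom_apply, map_pow]

/-- Shift and degree of the Kummer ToyTower.cover. [cite: MochizukiEtTh2009, Prop 4.2 p.89] -/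
@[simp] theorem cover_shift (A : Base) (N : ℕ+) : (ToyTower.cover A N).shift = 0 := rfl

/-- The Kummer ToyTower.cover `X_{N·M} → X_M` has degree `N`. [cite: MochizukiEtTh2009, Prop 4.2 p.89] -/
@[simp] theorem deg_cover (A : Base) (N : ℕ+) : deg (ToyTower.cover A N) = N := by
  change ((N * A.lvl : ℕ+) : ℕ) / (A.lvl : ℕ) = N
  rw [PNat.mul_coe, Nat.mul_div_cancel _ A.lvl.pos]

/-! ## `Φ` and `B` are monoids on the tower ([FrdI] Def 1.1 (ii)); the tower IS a Frobenioid -/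

/-- Pull-back along an isomorphism of the base is bijective. [cite: MochizukiFrdI2008, Def. 1.1(ii)] -/
private theorem bijective_pull_of_iso (Ψ : Baseᵒᵖ ⥤ CommMonCat.{0}) {A B : Base} (e : B ≅ A) :
    Function.Bijective (pull Ψ e.hom) := by
  refine Function.bijective_iff_has_inverse.mpr ⟨pull Ψ e.inv, fun x => ?_, fun y => ?_⟩
  · rw [← pull_comp, e.inv_hom_id, pull_id]
  · rw [← pull_comp, e.hom_inv_id, pull_id]

/-- **Covers of degree `> 1` are NOT monomorphisms** (deck transformations): a monomorphism `X_M → X_N` has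
`M = N`. [cite: MochizukiFrdI2008, §0 p.14] -/
theorem lvl_eq_of_mono {A B : Base} (f : A ⟶ B) [Mono f] : (A.lvl : ℕ) = B.lvl := by
  refine Nat.dvd_antisymm ?_ f.dvd
  let g : A ⟶ A := ⟨((B.lvl : ℕ) : ZMod A.lvl), dvd_rfl⟩
  have hg : g ≫ f = 𝟙 A ≫ f := hom_ext (by
    rw [comp_shift, comp_shift, id_shift, map_zero, map_natCast, ZMod.natCast_self])
  have h := congrArg Hom.shift (cancel_mono f |>.mp hg)
  change ((B.lvl : ℕ) : ZMod A.lvl) = 0 at h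
  exact (ZMod.natCast_eq_zero_iff _ _).mp h

/-- A monomorphism of the tower is an isomorphism (`Aut(X_N) = ℤ/N` acts transitively on fibres).
[cite: MochizukiFrdI2008, §0 p.14] -/
theorem exists_iso_of_mono {A B : Base} (f : B ⟶ A) [Mono f] : ∃ e : B ≅ A, e.hom = f := by
  have h := lvl_eq_of_mono f
  have hBA : (B.lvl : ℕ) ∣ A.lvl := by rw [h]
  refine ⟨⟨f, ⟨ZMod.castHom hBA (ZMod B.lvl) (-f.shift), hBA⟩, hom_ext ?_, hom_ext ?_⟩, rfl⟩
  · rw [comp_shift, id_shift]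
    change ZMod.castHom hBA _ f.shift + ZMod.castHom hBA _ (-f.shift) = 0
    rw [map_neg, add_neg_cancel]
  · rw [comp_shift, id_shift]
    change ZMod.castHom f.dvd _ (ZMod.castHom hBA _ (-f.shift)) + f.shift = 0
    have hc : (ZMod.castHom f.dvd (ZMod A.lvl)).comp (ZMod.castHom hBA (ZMod B.lvl)) = RingHom.id _ :=
      RingHom.ext_zmod _ _
    rw [← RingHom.comp_apply, hc, RingHom.id_apply, neg_add_cancel]

/-- FSM-morphisms of the tower pull back to bijections, for ANY functor. [cite: MochizukiFrdI2008, Def. 1.1(ii)] -/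
theorem bijective_pull_of_isFSM (Ψ : Baseᵒᵖ ⥤ CommMonCat.{0}) {A B : Base} (f : B ⟶ A) (hf : IsFSM f) :
    Function.Bijective (pull Ψ f) := by
  haveI := hf.2
  obtain ⟨e, he⟩ := exists_iso_of_mono f
  rw [← he]
  exact bijective_pull_of_iso Ψ e

/-- Pull-back of divisors along `f` is the `deg f`-th power map, on `Φ^gp`. [cite: MochizukiEtTh2009, Def 3.3 p.73] -/
theorem gpMap_pull {A B : Base} (f : B ⟶ A)
    (ξ : Algebra.GrothendieckGroup (ToyTower.temperedFrobenioid.Φ.carrier (op A))) :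
    gpMap (ToyTower.temperedFrobenioid.Φ.pull f.op) ξ = ξ ^ deg f := by
  change gpMap (powMonoidHom (deg f) :
      ToyTower.temperedFrobenioid.Φ.carrier (op A) →* ToyTower.temperedFrobenioid.Φ.carrier (op A)) ξ = ξ ^ deg f
  rw [gpMap_powMonoidHom']
  rfl

/-- An injective homomorphism into a sharp monoid is characteristically injective. [cite: MochizukiFrdI2008, §0 p.11] -/
private theorem isCharInjective_of_injective_of_isSharp' {M N : Type} [CommMonoid M] [CommMonoid N]
    (φ : M →* N) (hφ : Function.Injective φ) (hN : IsSharp N) : IsCharInjective φ := by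
  refine ⟨hφ, fun x y hxy => ?_⟩
  obtain ⟨a, rfl⟩ := Associates.mk_surjective x
  obtain ⟨b, rfl⟩ := Associates.mk_surjective y
  rw [associatesMap_mk, associatesMap_mk, Associates.mk_eq_mk_iff_associated] at hxy
  obtain ⟨u, hu⟩ := hxy
  have hu1 : (u : N) = 1 := hN.1 _ u.isUnit
  rw [hu1, mul_one] at hu
  rw [hφ hu]

/-- `Φ = ℚ_{≥0}` is a monoid on the tower: pull-backs (`× deg`) are injective into a sharp monoid, and
bijective along FSM-morphisms (= isomorphisms). [cite: MochizukiEtTh2009, Def 3.6 p.77] -/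
theorem divisorMonoid_isMonoidOn : IsMonoidOn ToyTower.temperedFrobenioid.divisorMonoid where
  isCharInjective {A B} f := by
    have h : (pull ToyTower.temperedFrobenioid.divisorMonoid f : _ → _) = fun x => x ^ deg f :=
      funext fun x => Subtype.ext rfl
    refine isCharInjective_of_injective_of_isSharp' _ ?_ (divisorMonoid_isDivisorial B).isSharp
    rw [h]
    exact ((temperedFrobenioid_isPerfect (op A)).1 _ (deg_pos f)).1
  bijective_of_isFSM f hf := bijective_pull_of_isFSM _ f hf

/-- Exponents: `n ↦ n^k` is injective on `t^ℤ` for `k ≥ 1`. [folklore] -/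
private theorem pow_injective_mulInt {k : ℕ} (hk : 0 < k) : Function.Injective fun n : Multiplicative ℤ => n ^ k := by
  intro a b h
  have h' := congrArg Multiplicative.toAdd h
  rw [toAdd_pow, toAdd_pow] at h'
  exact Multiplicative.toAdd.injective (nsmul_right_injective hk.ne' h')

/-- **`B = ℂˣ × t^ℤ` IS a monoid on the genuine tower** ([FrdI] Def 1.1 (ii)) — the clause that FAILED on the
collapsed base (`ToyCovZ.not_isMonoidOn_ratFnFunctor`, p430083): pull-backs are injective (`B` is a group, so
characteristically injective), and bijectivity is only demanded along FSM-morphisms, which here are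
isomorphisms. [cite: MochizukiFrdI2008, Def. 1.1(ii)] -/
theorem ratFnFunctor_isMonoidOn : IsMonoidOn ToyTower.temperedFrobenioid.ratFnFunctor where
  isCharInjective {A B} f := by
    haveI : IsCancelMul (ToyTower.temperedFrobenioid.Φ.carrier (op A)) :=
      isIntegral_iff_isCancelMul.mp (divisorMonoid_isDivisorial A).isPreDivisorial.isIntegral
    refine ⟨fun p q hpq => ?_, ?_⟩
    · have hv := congrArg Subtype.val hpq
      change (ToyTower.temperedFrobenioid.ratFnPull f.op p).1 = (ToyTower.temperedFrobenioid.ratFnPull f.op q).1 at hv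
      rw [TemperedFrobenioid.coe_ratFnPull, TemperedFrobenioid.coe_ratFnPull, Prod.mk.injEq, gpMap_pull,
        gpMap_pull] at hv
      have h1 := hv.1
      change pullFn f p.1.1 = pullFn f q.1.1 at h1
      rw [pullFn_apply, pullFn_apply, Prod.mk.injEq] at h1
      have hn : p.1.1.2 = q.1.1.2 := pow_injective_mulInt (deg_pos f) h1.2
      have hc : p.1.1.1 = q.1.1.1 := by
        have h1' := h1.1
        rw [hn] at h1'
        exact mul_right_cancel h1'
      have hξ : p.1.2 = q.1.2 :=
        ((isPerfect_grothendieckGroup (P := ToyTower.temperedFrobenioid.Φ.carrier (op A))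
          (temperedFrobenioid_isPerfect (op A))).bijective_pow _ (deg_pos f)).1 hv.2
      exact Subtype.ext (Prod.ext (Prod.ext hc hn) hξ)
    · haveI : Subsingleton (Associates (ToyTower.temperedFrobenioid.ratFnFunctor.obj (op A))) := ⟨fun x y => by
        obtain ⟨a, rfl⟩ := Associates.mk_surjective x
        obtain ⟨b, rfl⟩ := Associates.mk_surjective y
        obtain ⟨ua, hua⟩ := (ratFnFunctor_isGroupLike A).isUnit a
        obtain ⟨ub, hub⟩ := (ratFnFunctor_isGroupLike A).isUnit b
        exact Associates.mk_eq_mk_iff_associated.mpr ⟨ua⁻¹ * ub, by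
          rw [← hua, Units.val_mul, ← mul_assoc, Units.mul_inv, one_mul, hub]⟩⟩
      exact Function.injective_of_subsingleton _
  bijective_of_isFSM f hf := bijective_pull_of_isFSM _ f hf

/-- **The tower tempered Frobenioid IS a Frobenioid** (REAL `PreFrobenioid.IsFrobenioid`, L1's [FrdI] Thm 5.2 (ii)
`ModelFrobenioid.isFrobenioid`) — with INTEGRAL exponents. [cite: MochizukiEtTh2009, Thm 3.7 p.79] -/
theorem temperedFrobenioid_isFrobenioid : PreFrobenioid.IsFrobenioid ToyTower.temperedFrobenioid.toElem :=
  ModelFrobenioid.isFrobenioid divisorMonoid_isMonoidOn divisorMonoid_isDivisorial ratFnFunctor_isMonoidOn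
    ratFnFunctor_isGroupLike (isGraphConnected_iff_isConnected.2 ToyTower.temperedFrobenioid.isConnected)
    ToyTower.temperedFrobenioid.isTotallyEpimorphic

/-! ## Roots exist ONLY upstairs -/

/-- **No `N`-th root of the uniformiser downstairs** (`N ≥ 2`): `t_M` has no `N`-th root in `B(X_M) = ℂˣ × t_M^ℤ`
(`N · n = 1` is insoluble). [cite: MochizukiEtTh2009, Prop 4.2 p.89] -/
theorem not_exists_pow_eq_unif (A : Base) {N : ℕ} (hN : 2 ≤ N) :
    ¬ ∃ g : ToyTower.temperedFrobenioid.ratFnFunctor.obj (op A), g ^ N = ToyTower.unif A := by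
  rintro ⟨g, hg⟩
  have h := congrArg (fun r : ToyTower.temperedFrobenioid.ratFnFunctor.obj (op A) => Multiplicative.toAdd r.1.1.2) hg
  change Multiplicative.toAdd (g.1.1.2 ^ N) = Multiplicative.toAdd (Multiplicative.ofAdd (1 : ℤ)) at h
  rw [toAdd_ofAdd, toAdd_pow, nsmul_eq_mul] at h
  have h2 : (2 : ℤ) ≤ N := by exact_mod_cast hN
  rcases le_or_gt (Multiplicative.toAdd g.1.1.2) 0 with hle | hlt
  · nlinarith
  · nlinarith

/-- The twist of a shift-`0` morphism is trivial. [cite: MochizukiEtTh2009, Def 3.3 p.73] -/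
theorem twist_eq_one {A B : Base} (f : A ⟶ B) (hf : f.shift = 0) (n : Multiplicative ℤ) : twist f n = 1 := by
  haveI : NeZero ((B.lvl : ℕ)) := ⟨B.lvl.ne_zero⟩
  rw [twist_apply, hf, mul_zero, AddChar.map_zero_eq_one, map_one]

/-- `ℂˣ` is divisible. [folklore] -/
private theorem exists_pow_eq_const (c : ℂˣ) (N : ℕ+) : ∃ c' : ℂˣ, c' ^ (N : ℕ) = c := by
  obtain ⟨z, hz⟩ := IsAlgClosed.exists_pow_nat_eq (c : ℂ) (PNat.pos N)
  have hu : IsUnit z := (isUnit_pow_iff (PNat.ne_zero N)).mp (hz ▸ c.isUnit)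
  exact ⟨hu.unit, Units.ext (by simp [hz])⟩

/-- **The `N`-th root upstairs**: along `X_{N·M} → X_M`, `c · t_M^n ↦ c · t_{NM}^{Nn} = (c^{1/N} t_{NM}^n)^N`.
[cite: MochizukiEtTh2009, Prop 4.2 p.89] -/
theorem exists_pow_eq_pull_cover (A : Base) (N : ℕ+) (f : ToyTower.temperedFrobenioid.ratFnFunctor.obj (op A)) :
    ∃ g : ToyTower.temperedFrobenioid.ratFnFunctor.obj (op (ToyTower.coverObj A N)),
      g ^ (N : ℕ) = pull ToyTower.temperedFrobenioid.ratFnFunctor (ToyTower.cover A N) f := by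
  obtain ⟨c', hc'⟩ := exists_pow_eq_const f.1.1.1 N
  refine ⟨⟨((c', f.1.1.2), f.1.2), f.2⟩, Subtype.ext ?_⟩
  change ((c', f.1.1.2), f.1.2) ^ (N : ℕ) = (ToyTower.temperedFrobenioid.ratFnPull (ToyTower.cover A N).op f).1
  rw [TemperedFrobenioid.coe_ratFnPull, Prod.pow_mk, Prod.pow_mk, hc', gpMap_pull, deg_cover]
  refine Prod.ext ?_ rfl
  change ((f.1.1.1, f.1.1.2 ^ (N : ℕ)) : Fn) = pullFn (ToyTower.cover A N) f.1.1
  rw [pullFn_apply, twist_eq_one _ (cover_shift A N), mul_one, deg_cover]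

/-- **Roots ONLY upstairs, with `C` a Frobenioid**: the uniformiser `t_M` has no square root on `X_M` but
acquires one on `X_{2M}` — ERRATUM E2 in the kernel at a setting that IS a Frobenioid (the cell `ToyCovZ` could
not fill). [cite: MochizukiEtTh2009, Prop 4.2 p.89] -/
theorem roots_only_upstairs (A : Base) :
    PreFrobenioid.IsFrobenioid ToyTower.temperedFrobenioid.toElem ∧
      (¬ ∃ g : ToyTower.temperedFrobenioid.ratFnFunctor.obj (op A), g ^ 2 = ToyTower.unif A) ∧
      ∃ g : ToyTower.temperedFrobenioid.ratFnFunctor.obj (op (ToyTower.coverObj A 2)),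
        g ^ 2 = pull ToyTower.temperedFrobenioid.ratFnFunctor (ToyTower.cover A 2) (ToyTower.unif A) :=
  ⟨temperedFrobenioid_isFrobenioid, not_exists_pow_eq_unif A le_rfl, exists_pow_eq_pull_cover A 2 (ToyTower.unif A)⟩

/-! ## The laws of the Prop 4.2 (iii)∧(iv) floor hold at the tower; the closers fire -/

variable (p : ℕ) [Fact p.Prime]

/-- **The Def 4.1 (ii) naturality law `hS` HOLDS on the tower**: along `b : X_M → X_N` the Galois actions are
compatible (they factor through the abelian `Π^tp_X ↠ ℤ`; `c := 1`). [cite: MochizukiEtTh2009, Def 4.1 p.87] -/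
theorem naturalityLaw ⦃A B : Base⦄ (hA : True) (hB : True) (b : B ⟶ A) :
    ∃ c : (ToyTower.temperedGroup p).Pi, ∀ g : (ToyTower.temperedGroup p).Pi,
      (ToyTower.galoisSurj p B hB g).hom ≫ b = b ≫ (ToyTower.galoisSurj p A hA (c * g * c⁻¹)).hom :=
  ⟨1, fun g => hom_ext (by
    rw [one_mul, inv_one, mul_one, comp_shift, comp_shift, galoisSurj_apply_hom_shift,
      galoisSurj_apply_hom_shift, map_intCast, castHom_self_apply', add_comm])⟩

/-- **The E2 root law `hR` HOLDS on the tower**, by the Kummer ToyTower.cover `X_{N·M} → X_M`. [cite: MochizukiEtTh2009, Prop 4.2 p.89] -/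
theorem rootLaw (N : ℕ+) (A : Base) (_hA : True) (f : ToyTower.temperedFrobenioid.ratFnFunctor.obj (op A)) :
    ∃ (A' : Base) (_ : True) (b : A' ⟶ A) (g : ToyTower.temperedFrobenioid.ratFnFunctor.obj (op A')),
      g ^ (N : ℕ) = pull ToyTower.temperedFrobenioid.ratFnFunctor b f :=
  ⟨ToyTower.coverObj A N, trivial, ToyTower.cover A N, exists_pow_eq_pull_cover A N f⟩

/-- An element of `B(A^bs)` with `Div_B = 0` is a constant. [cite: MochizukiEtTh2009, Def 3.6 p.77] -/
theorem eq_cnst_of_divB_eq_one (A : ToyTower.temperedFrobenioid.category)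
    (ξ : ToyTower.temperedFrobenioid.ratFnFunctor.obj (op A.base))
    (hξ : divB ToyTower.temperedFrobenioid.divisorMonoid ToyTower.temperedFrobenioid.ratFnFunctor ToyTower.temperedFrobenioid.divBNatTrans
      (op A.base) ξ = 1) :
    ξ = ToyTower.cnst A ξ.1.1.1 := by
  have h2 : ξ.1.2 = 1 := hξ
  have h12 : ξ.1.1.2 = 1 := by
    have hrel := ξ.2
    change Toy.divHomQ _ = ToyTower.temperedFrobenioid.ΦgpToRlog _ _ at hrel
    rw [h2, map_one] at hrel
    exact Toy.divHomQ_injective (hrel.trans (map_one Toy.divHomQ).symm)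
  exact Subtype.ext (Prod.ext (Prod.ext rfl h12) h2)

/-- Constants pull back to constants along every arrow of the tower (`ζ^{a·0} = 1`). [cite: MochizukiEtTh2009, Def 3.3 p.73] -/
theorem pull_cnst (A A' : ToyTower.temperedFrobenioid.category) (g : A'.base ⟶ A.base) (c : ℂˣ) :
    pull ToyTower.temperedFrobenioid.ratFnFunctor g (ToyTower.cnst A c) = ToyTower.cnst A' c := by
  apply Subtype.ext
  change (ToyTower.temperedFrobenioid.ratFnPull g.op (ToyTower.cnst A c)).1 = (ToyTower.cnst A' c).1
  rw [TemperedFrobenioid.coe_ratFnPull]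
  change (pullFn g ((c, 1) : Fn), gpMap (ToyTower.temperedFrobenioid.Φ.pull g.op) 1) = ((((c, 1) : Fn)), 1)
  rw [map_one, pullFn_apply, map_one, mul_one, one_pow]

/-- Powers of constants are constants. [cite: MochizukiEtTh2009, Def 3.6 p.77] -/
theorem cnst_pow (A : ToyTower.temperedFrobenioid.category) (c : ℂˣ) (n : ℕ) : ToyTower.cnst A c ^ n = ToyTower.cnst A (c ^ n) := by
  have h := congrArg Units.val (map_pow (ToyTower.cnstUnitHom A) c n)
  rw [Units.val_pow_eq_pow_val] at h
  exact h.symm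

/-- **The roots-of-constants law `hL` HOLDS on the tower.** [cite: MochizukiEtTh2009, Prop 4.2 p.90] -/
theorem constantRootLaw (A'' : ToyTower.temperedFrobenioid.category) (N : ℕ+) (g : A''.base ⟶ ToyTower.Aodot.base)
    (ξ : ToyTower.temperedFrobenioid.ratFnFunctor.obj (op ToyTower.Aodot.base))
    (_hft : PreFrobenioid.IsFrobeniusTrivial ToyTower.temperedFrobenioid.toElem A'') (_hNH : True)
    (hξ : divB ToyTower.temperedFrobenioid.divisorMonoid ToyTower.temperedFrobenioid.ratFnFunctor ToyTower.temperedFrobenioid.divBNatTrans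
      (op ToyTower.Aodot.base) ξ = 1) :
    ∃ ζ : ToyTower.temperedFrobenioid.ratFnFunctor.obj (op A''.base), ζ ^ (N : ℕ) = pull ToyTower.temperedFrobenioid.ratFnFunctor g ξ := by
  obtain ⟨c', hc'⟩ := exists_pow_eq_const ξ.1.1.1 N
  have hξ' := eq_cnst_of_divB_eq_one ToyTower.Aodot ξ hξ
  refine ⟨ToyTower.cnst A'' c', ?_⟩
  rw [hξ', pull_cnst, cnst_pow, hc']

/-- **The refinement law `hE` HOLDS on the tower** (identity refinement; every object is `μ_N`-saturated).
[cite: MochizukiEtTh2009, Prop 4.2 p.90] -/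
theorem refinementLaw (N : ℕ+) (A' : ToyTower.temperedFrobenioid.category)
    (_hft : PreFrobenioid.IsFrobeniusTrivial ToyTower.temperedFrobenioid.toElem A') (_hG : True) :
    ∃ (A'' : ToyTower.temperedFrobenioid.category) (ψ : A'' ⟶ A'),
      PreFrobenioid.IsPullbackMorphism ToyTower.temperedFrobenioid.toElem ψ ∧ True ∧
        ToyTower.temperedFrobenioid.IsMuSaturated A'' N ∧ True :=
  ⟨A', 𝟙 A', ModelFrobenioid.isPullbackMorphism_of divisorMonoid_isDivisorial ratFnFunctor_isGroupLike rfl rfl,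
    trivial, isMuSaturated A' N, trivial⟩

/-- In `ℚ_{≥0}` (written multiplicatively), `x ≤ y` gives `x ∣ y`. [folklore] -/
private theorem dvd_of_le' {x y : (⊤ : Submonoid (Multiplicative ℚ≥0))}
    (h : Multiplicative.toAdd x.1 ≤ Multiplicative.toAdd y.1) : x ∣ y := by
  obtain ⟨d, hd⟩ := exists_add_of_le h
  refine ⟨⟨Multiplicative.ofAdd d, trivial⟩, Subtype.ext ?_⟩
  change y.1 = x.1 * Multiplicative.ofAdd d
  apply Multiplicative.toAdd.injective
  rw [toAdd_mul, toAdd_ofAdd, hd]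

/-- Coprime elements of `ℚ_{≥0}`: one of them is `0`. [folklore] -/
private theorem coprime_cases {a b : (⊤ : Submonoid (Multiplicative ℚ≥0))}
    (h : ∀ x : (⊤ : Submonoid (Multiplicative ℚ≥0)), x ∣ a → x ∣ b → x = 1) : a = 1 ∨ b = 1 := by
  rcases le_total (Multiplicative.toAdd a.1) (Multiplicative.toAdd b.1) with hab | hba
  · exact Or.inl (h a (dvd_refl a) (dvd_of_le' hab))
  · exact Or.inr (h b (dvd_of_le' hba) (dvd_refl b))

/-- **The [FrdI] Prop 4.1 (iii) coprimality law `hDSpull` HOLDS on the tower.** [cite: MochizukiEtTh2009, Prop 4.2 p.89] -/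
theorem coprime_pull {A A' : Base} (e : A' ⟶ A) {a b : ToyTower.temperedFrobenioid.Φ.carrier (op A)}
    (h : ∀ x : ToyTower.temperedFrobenioid.Φ.carrier (op A), x ∣ a → x ∣ b → x = 1)
    (y : ToyTower.temperedFrobenioid.Φ.carrier (op A')) (hya : y ∣ pull ToyTower.temperedFrobenioid.divisorMonoid e a)
    (hyb : y ∣ pull ToyTower.temperedFrobenioid.divisorMonoid e b) : y = 1 := by
  rcases coprime_cases h with ha | hb
  · have h1 : pull ToyTower.temperedFrobenioid.divisorMonoid e a = 1 := by rw [ha]; exact map_one _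
    rw [h1] at hya
    exact (divisorMonoid_isDivisorial A').isSharp.eq_one_of_isUnit y (isUnit_of_dvd_one hya)
  · have h1 : pull ToyTower.temperedFrobenioid.divisorMonoid e b = 1 := by rw [hb]; exact map_one _
    rw [h1] at hyb
    exact (divisorMonoid_isDivisorial A').isSharp.eq_one_of_isUnit y (isUnit_of_dvd_one hyb)

/-- **The six laws hold TOGETHER on the genuine tower, and the floor closer of record
`Prop42Sub.prop42_iii_iv_mkOfModelCanonical_of_laws` FIRES: [EtTh] Prop 4.2 (iii) ∧ (iv) AS TYPED at the tower
setting** — with `C` a Frobenioid, integral exponents, roots only upstairs, Galois groups `ℤ/N`.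
[cite: MochizukiEtTh2009, Prop 4.2 p.88] -/
theorem laws_and_prop42_iii_iv :
    PreFrobenioid.IsFrobenioid ToyTower.temperedFrobenioid.toElem ∧
    (∀ A : Base, ¬ ∃ g : ToyTower.temperedFrobenioid.ratFnFunctor.obj (op A), g ^ 2 = ToyTower.unif A) ∧
    (ToyTower.biKummerSetting p).Prop42_iii (fun {_ _} φ x => ToyTower.temperedFrobenioid.pullFracModel φ x) ∧
    (ToyTower.biKummerSetting p).Prop42_iv (fun φ x => ToyTower.temperedFrobenioid.pullFracModel φ x) :=
  ⟨temperedFrobenioid_isFrobenioid, fun A => not_exists_pow_eq_unif A le_rfl,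
    BiKummerSetting.Prop42Sub.prop42_iii_iv_mkOfModelCanonical_of_laws (ToyTower.temperedGroup p) ToyTower.temperedFrobenioid
      temperedFrobenioid_monoidType temperedFrobenioid_isPerfect (fun _ => True) (ToyTower.galoisSurj p)
      (galoisSurj_surjective p) (fun _ _ _ => True) ToyTower.Aodot isFrobeniusTrivial_Aodot trivial divisorMonoid_isDivisorial
      (fun e _ _ h y hya hyb => coprime_pull e h y hya hyb) rootLaw refinementLaw (naturalityLaw p) constantRootLaw⟩

/-- **The `B₀^Λ`-level root law `hR₀` HOLDS on the tower.** [cite: MochizukiEtTh2009, Def 3.6 p.77] -/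
theorem baseRootLaw (N : ℕ+) (A : Base) (_hA : True)
    (b : ToyTower.realified.BΛ.obj (op (ToyTower.temperedFrobenioid.base.obj A))) :
    ∃ (A' : Base) (_ : True) (c : A' ⟶ A) (b' : ToyTower.realified.BΛ.obj (op (ToyTower.temperedFrobenioid.base.obj A'))),
      b' ^ (N : ℕ) = (ToyTower.realified.BΛ.map (ToyTower.temperedFrobenioid.base.map c).op).hom b := by
  obtain ⟨c', hc'⟩ := exists_pow_eq_const (b : Fn).1 N
  refine ⟨ToyTower.coverObj A N, trivial, ToyTower.cover A N, ((c', (b : Fn).2) : Fn), ?_⟩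
  change ((c', (b : Fn).2) : Fn) ^ (N : ℕ) = pullFn (ToyTower.cover A N) b
  rw [pullFn_apply, Prod.pow_mk, hc', twist_eq_one _ (cover_shift A N), mul_one, deg_cover]

/-- **`hTF` HOLDS on the tower**: `N`-th powers are injective in `(Φ^{ℝ-log})^gp = (ℚ_{≥0})^gp`.
[cite: MochizukiFrdI2008, §0 p.11] -/
theorem pow_injective_ΦR_gp (A : Base) (N : ℕ) (hN : 0 < N) :
    Function.Injective fun x : Algebra.GrothendieckGroup
      (ToyTower.realified.ΦR.obj (op (ToyTower.temperedFrobenioid.base.obj A))) => x ^ N :=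
  ((isPerfect_grothendieckGroup (P := Multiplicative ℚ≥0) isPerfect_multiplicative_nnrat).bijective_pow N hN).1

/-- **The deeper floor {`Φ` divisorial, `hDSpull`, `hR₀`, `hTF`, `hE`, `hS`, `hL`} holds TOGETHER on the tower,
and `prop42_iii_iv_mkOfModelCanonical_of_baseRootLaw` (p432007) FIRES.** [cite: MochizukiEtTh2009, Prop 4.2 p.88] -/
theorem baseLaws_and_prop42_iii_iv :
    (ToyTower.biKummerSetting p).Prop42_iii (fun {_ _} φ x => ToyTower.temperedFrobenioid.pullFracModel φ x) ∧
    (ToyTower.biKummerSetting p).Prop42_iv (fun φ x => ToyTower.temperedFrobenioid.pullFracModel φ x) :=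
  BiKummerSetting.Prop42Sub.prop42_iii_iv_mkOfModelCanonical_of_baseRootLaw (ToyTower.temperedGroup p)
    ToyTower.temperedFrobenioid temperedFrobenioid_monoidType temperedFrobenioid_isPerfect (fun _ => True) (ToyTower.galoisSurj p)
    (galoisSurj_surjective p) (fun _ _ _ => True) ToyTower.Aodot isFrobeniusTrivial_Aodot trivial divisorMonoid_isDivisorial
    (fun e _ _ h y hya hyb => coprime_pull e h y hya hyb) pow_injective_ΦR_gp baseRootLaw refinementLaw
    (naturalityLaw p) constantRootLaw


end ToyTower

end Literature.AnabelianGeometry.EtaleTheta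

end
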